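import Summits.AtomisticToContinuum.FouriersLaw.Theorems.BondHeatUncertaintySubdiffusiveBondHeatCurrentCorrectorGrading
import Summits.AtomisticToContinuum.FouriersLaw.Theses.ChannelExclusionTauberian

/-!
# The zero-defect junction law needs NO RATE: `SplitLaw 0 ∧ (E_N → 0) ⟹ 11071`, and the junction mechanism EXCLUDES ANOMALOUS CHANNELS

Support file for stmt-AtomisticToContinuum-11071 (`BondHeatUncertainty.BoundedResponse`; residual of record 11071 ∧ 9121),
decomposition cell `decomp-a2c`, lens-1 (grading), gen 57 — file (8) (imports (7c) `…CurrentCorrectorGrading` and the route file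
`Theses.ChannelExclusionTauberian` for the two channel cruxes `NoBallisticChannel` (stmt-28286) and `NoAnomalousChannel` (stmt-28285)).

THE OBSERVATION (end point of the grading `SplitLaw θ ∧ ExponentFloor s ⟹ 11071`, `θ < s`).  The tree kernel
`JunctionDefectGrading.linear_of_split_of_floor` uses the floor `c·N^s ≤ r_N` ONLY on its seed window `[N₀, 3N₀)`, to dominate the
defect budget `B·N^θ`.  At `θ = 0` (constant junction defect `C` — the exponent delivered by the mechanism pieces `BufferedJunctionLaw` and
`LocalityPassivityLaw` of file (5)) the defect is absorbed by the SHIFT `r'_N := r_N − C`, which obeys the EXACT split law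
`r'_u + r'_v ≤ r'_N`; the tree kernel then runs with exponents `(θ, s) = (−1, 0)` and needs only `r'_N ≥ c > 0` eventually, i.e.
`E_N ≤ 1/(C + c)` eventually.  Hence NO RATE is needed on the floor side:

* `escapeFloor_one_of_splitZero_of_tendsto` (per temperature) and `ohmicFloor_of_splitLaw_zero_of_escapeVanishing :
  SplitLaw 0 → EscapeVanishing → OhmicFloor`, where `EscapeVanishing` (`E_N(T) → 0` for every `T > 0`) is the escape-deficit
  currency of CET's crux `NoBallisticChannel` (`D_N/N → 0`; `escapeVanishing_iff_noBallisticChannel`, proved here from the response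
  identity `D_N = (N−1)γE_N`, uniqueness and existence of steady states — all tree theorems, by name).
* THE NODE WITH A LEDGER PARTNER: `boundedResponse_of_localityPassivityLaw_of_noBallisticChannel :
  LocalityPassivityLaw → NoBallisticChannel → BoundedResponse` — 11071 ⟸ (junction locality ∧ buffer passivity) ∧ stmt-28286; likewise
  from `BufferedJunctionLaw`, and from `SplitLaw θ` for every `θ ≤ 0`.
* CET's RANK-2 CRUX IS DISCHARGED BY THE JUNCTION PIECE: `noAnomalousChannel_of_splitLaw_zero : SplitLaw 0 → NoAnomalousChannel`
  (per temperature, along the GIVEN steady-state family: sub-ballistic `D_N/N → 0` ⟹ `sup_N |D_N| < ∞`), hence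
  `noAnomalousChannel_of_localityPassivityLaw`, `noAnomalousChannel_of_bufferedJunctionLaw`.  Informally: a junction law with bounded
  defect admits NO ANOMALOUS EXPONENT — the response is either bounded or not even sub-ballistic.
* The corrector side feeds the partner: `noBallisticChannel_of_currentCorrectorBudget (a < 3)` and
  `noBallisticChannel_of_coneScaleCorrector : ConeScaleCorrector → NoBallisticChannel` (crux E1, stmt-14069, ⟹ stmt-28286).

DOCKET (lens-1, final for gen 57): the `LocalityPassivityLaw`-node of 11071 closes with the floor side weakened all the way down to
`NoBallisticChannel` 28286 = «`F(0⁺)` without rate» (fed by `CurrentCorrectorBudget a` for any `a < 3`, by E1, by every `ExponentFloor s`,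
`s > 0`); for `θ > 0` the tree kernel still needs `s > θ`.  What this file does NOT do: prove `SplitLaw 0`, `LocalityPassivityLaw`,
`NoBallisticChannel` or `E1` (open mechanism pieces), nor a converse `NoAnomalousChannel → SplitLaw 0`.

Abstract real-sequence lemmas first (`[folklore]`), then the per-temperature kernel (`[kernel]`), the `Prop` `EscapeVanishing`
(`[piece · rung]`, EQUIV to 28286), the bridge and the pairings BY NAME (`[kernel · frame]`).  No `sorry`; standard axioms; nothing here
closes an item.
-/

noncomputable section

open MeasureTheory Filter Topology Set
open scoped BigOperators

namespace Summit.AtomisticToContinuum.FouriersLaw.Theorems.SubdiffusiveBondHeat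

namespace EscapeGrading

open Literature.MathematicalPhysics.KineticTheory.HeatConduction
open Summit.AtomisticToContinuum.FouriersLaw.Theses.BondHeatUncertainty (BoundedResponse)
open Summit.AtomisticToContinuum.FouriersLaw.Theses.OddSectorIrreversibility (ConeScaleCorrector)
open Summit.AtomisticToContinuum.FouriersLaw.Theses.ChannelExclusionTauberian (NoBallisticChannel NoAnomalousChannel)

/-! ## Abstract real-sequence lemmas -/

/-- An eventually bounded real sequence has bounded range (the finitely many early terms are absorbed by `∑_{n<N₀} |f n|`). [folklore] -/
theorem bddAbove_range_of_eventually_le {f : ℕ → ℝ} {M : ℝ} {N₀ : ℕ} (h : ∀ N : ℕ, N₀ ≤ N → f N ≤ M) :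
    BddAbove (Set.range f) := by
  refine ⟨max M 0 + ∑ n ∈ Finset.range N₀, |f n|, ?_⟩
  rintro x ⟨N, rfl⟩
  have hsum : 0 ≤ ∑ n ∈ Finset.range N₀, |f n| := Finset.sum_nonneg fun n _ => abs_nonneg (f n)
  by_cases hN : N₀ ≤ N
  · exact le_trans (h N hN) (le_trans (le_max_left M 0) (le_add_of_nonneg_right hsum))
  · push Not at hN
    have h1 : f N ≤ |f N| := le_abs_self (f N)
    have h2 : |f N| ≤ ∑ n ∈ Finset.range N₀, |f n| :=
      Finset.single_le_sum (f := fun n => |f n|) (fun n _ => abs_nonneg (f n)) (Finset.mem_range.2 hN)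
    exact le_trans h1 (le_trans h2 (le_add_of_nonneg_left (le_max_right M 0)))

/-- `D_N = (N−1)γE_N` (`N ≥ 1`), `E_N ≥ 0` (`N ≥ 2`) and `D_N/N → 0` give `E_N → 0` (`E_N ≤ (2/γ)·D_N/N` for `N ≥ 2`). [folklore] -/
theorem tendsto_escape_zero_of_response_div {E D : ℕ → ℝ} {γ : ℝ} (hγ : 0 < γ)
    (hE0 : ∀ N : ℕ, 2 ≤ N → 0 ≤ E N) (hDE : ∀ N : ℕ, 0 < N → D N = ((N : ℝ) - 1) * γ * E N)
    (h : Tendsto (fun N : ℕ => D N / (N : ℝ)) atTop (𝓝 0)) : Tendsto E atTop (𝓝 0) := by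
  have hg : Tendsto (fun N : ℕ => 2 / γ * (D N / (N : ℝ))) atTop (𝓝 0) := by
    simpa using h.const_mul (2 / γ)
  refine squeeze_zero' ?_ ?_ hg
  · filter_upwards [eventually_ge_atTop 2] with N hN using hE0 N hN
  · filter_upwards [eventually_ge_atTop 2] with N hN
    have hNpos : (0 : ℝ) < N := by exact_mod_cast lt_of_lt_of_le (by norm_num) hN
    have hN2 : (2 : ℝ) ≤ N := by exact_mod_cast hN
    have hid : 2 / γ * (D N / (N : ℝ)) = E N * (2 * ((N : ℝ) - 1) / N) := by
      rw [hDE N (by omega)]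
      field_simp
    rw [hid]
    refine le_mul_of_one_le_right (hE0 N hN) ?_
    rw [le_div_iff₀ hNpos]
    linarith

/-- `D_N = (N−1)γE_N` (`N ≥ 1`), `E_N ≥ 0` (`N ≥ 2`) and `E_N → 0` give `D_N/N → 0` (`0 ≤ D_N/N ≤ γ·E_N` for `N ≥ 2`). [folklore] -/
theorem tendsto_response_div_zero_of_escape {E D : ℕ → ℝ} {γ : ℝ} (hγ : 0 < γ)
    (hE0 : ∀ N : ℕ, 2 ≤ N → 0 ≤ E N) (hDE : ∀ N : ℕ, 0 < N → D N = ((N : ℝ) - 1) * γ * E N)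
    (h : Tendsto E atTop (𝓝 0)) : Tendsto (fun N : ℕ => D N / (N : ℝ)) atTop (𝓝 0) := by
  have hg : Tendsto (fun N : ℕ => γ * E N) atTop (𝓝 0) := by
    simpa using h.const_mul γ
  refine squeeze_zero' ?_ ?_ hg
  · filter_upwards [eventually_ge_atTop 2] with N hN
    have hNpos : (0 : ℝ) < N := by exact_mod_cast lt_of_lt_of_le (by norm_num) hN
    have hN1 : (1 : ℝ) ≤ N := by exact_mod_cast le_trans (by norm_num : 1 ≤ 2) hN
    rw [hDE N (by omega)]
    exact div_nonneg (mul_nonneg (mul_nonneg (by linarith) hγ.le) (hE0 N hN)) hNpos.le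
  · filter_upwards [eventually_ge_atTop 2] with N hN
    have hNpos : (0 : ℝ) < N := by exact_mod_cast lt_of_lt_of_le (by norm_num) hN
    rw [hDE N (by omega), div_le_iff₀ hNpos]
    have h1 : ((N : ℝ) - 1) * γ * E N = γ * E N * ((N : ℝ) - 1) := by ring
    rw [h1]
    exact mul_le_mul_of_nonneg_left (by linarith) (mul_nonneg hγ.le (hE0 N hN))

/-- `D_N = (N−1)γE_N` (`N ≥ 1`), `E_N ≥ 0` (`N ≥ 2`) and the Ohmic floor `E_N ≤ C₁/N` (`N ≥ N₀`) give `|D_N| ≤ γ·max C₁ 0` for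
`N ≥ max N₀ 2`. [folklore] -/
theorem abs_response_le_of_escapeFloor_one {E D : ℕ → ℝ} {γ C₁ : ℝ} {N₀ : ℕ} (hγ : 0 < γ)
    (hE0 : ∀ N : ℕ, 2 ≤ N → 0 ≤ E N) (hDE : ∀ N : ℕ, 0 < N → D N = ((N : ℝ) - 1) * γ * E N)
    (hfl : ∀ N : ℕ, N₀ ≤ N → E N ≤ C₁ / (N : ℝ)) :
    ∀ N : ℕ, max N₀ 2 ≤ N → |D N| ≤ γ * max C₁ 0 := by
  intro N hN
  have hN2 : 2 ≤ N := le_trans (le_max_right _ _) hN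
  have hNpos : (0 : ℝ) < N := by exact_mod_cast lt_of_lt_of_le (by norm_num) hN2
  have hN1 : (1 : ℝ) ≤ N := by exact_mod_cast le_trans (by norm_num : 1 ≤ 2) hN2
  have hE := hE0 N hN2
  have hDN : D N = ((N : ℝ) - 1) * γ * E N := hDE N (by omega)
  have hD0 : 0 ≤ D N := by rw [hDN]; exact mul_nonneg (mul_nonneg (by linarith) hγ.le) hE
  rw [abs_of_nonneg hD0, hDN]
  have hEle : E N ≤ max C₁ 0 / (N : ℝ) :=
    le_trans (hfl N (le_trans (le_max_left _ _) hN)) (div_le_div_of_nonneg_right (le_max_left C₁ 0) hNpos.le)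
  have hEN : E N * (N : ℝ) ≤ max C₁ 0 := (le_div_iff₀ hNpos).mp hEle
  have hM0 : 0 ≤ max C₁ 0 := le_max_right C₁ 0
  nlinarith [mul_nonneg hγ.le hE, mul_nonneg hγ.le hM0]

/-! ## The kernel at zero defect, per temperature: a constant-defect split law plus `E_N → 0` gives the Ohmic floor -/

/-- **Zero-defect kernel, no rate.**  At fixed parameters and temperature: if for every `N ≥ N₂` some balanced split `N = u + L + v`
(`N ≤ 3u`, `N ≤ 3v`, buffer `L ≤ C·N^b`, `b < 1`) satisfies `1/E_u + 1/E_v − C ≤ 1/E_N`, and `E_N → 0`, then `E_N ≤ C₁/N` eventually.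
Proof: the shifted resistance `r'_N = 1/E_N − C` obeys the exact split law, `r'_N ≥ 1` once `E_N ≤ 1/(C+1)` (`E_N > 0`,
`escapeDeficit_pos`), and the tree kernel `linear_of_split_of_floor` with `(θ, s) = (−1, 0)` gives `a·N ≤ r'_N ≤ 1/E_N`. [kernel] -/
theorem escapeFloor_one_of_splitZero_of_tendsto {ω₂ lam β γ T : ℝ} (hω : 0 < ω₂) (hl : 0 < lam) (hβ : 0 < β)
    (hγ : 0 < γ) (hT : 0 < T) {C b : ℝ} {N₂ : ℕ} (hC : 0 ≤ C) (hb : b < 1)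
    (hS : ∀ N : ℕ, N₂ ≤ N → ∃ u v : ℕ, N ≤ 3 * u ∧ N ≤ 3 * v ∧ u + v ≤ N ∧ (N : ℝ) - u - v ≤ C * (N : ℝ) ^ b ∧
      1 / escapeDeficit ω₂ lam β γ T u + 1 / escapeDeficit ω₂ lam β γ T v - C ≤ 1 / escapeDeficit ω₂ lam β γ T N)
    (hV : Tendsto (fun N : ℕ => escapeDeficit ω₂ lam β γ T N) atTop (𝓝 0)) :
    ∃ C₁ : ℝ, ∃ N₀ : ℕ, ∀ N : ℕ, N₀ ≤ N → escapeDeficit ω₂ lam β γ T N ≤ C₁ / (N : ℝ) := by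
  have hpos : ∀ N : ℕ, 2 ≤ N → 0 < escapeDeficit ω₂ lam β γ T N := fun N hN =>
    JunctionDefectGrading.escapeDeficit_pos hω hl hβ hγ hT hN
  -- the threshold `E_N ≤ 1/(C+1)` eventually
  have hδ : (0 : ℝ) < 1 / (C + 1) := by positivity
  obtain ⟨N₁, hN₁⟩ := eventually_atTop.1 (hV.eventually (ge_mem_nhds hδ))
  -- the shifted resistance obeys the exact split law (defect `0 ≤ C·N^{-1}`)
  have hJ' : ∀ N : ℕ, N₂ ≤ N → ∃ u v : ℕ, N ≤ 3 * u ∧ N ≤ 3 * v ∧ u + v ≤ N ∧ (N : ℝ) - u - v ≤ C * (N : ℝ) ^ b ∧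
      (1 / escapeDeficit ω₂ lam β γ T u - C) + (1 / escapeDeficit ω₂ lam β γ T v - C) - C * (N : ℝ) ^ (-1 : ℝ)
        ≤ 1 / escapeDeficit ω₂ lam β γ T N - C := by
    intro N hN
    obtain ⟨u, v, h1, h2, h3, h4, h5⟩ := hS N hN
    refine ⟨u, v, h1, h2, h3, h4, ?_⟩
    have h6 : 0 ≤ C * (N : ℝ) ^ (-1 : ℝ) := mul_nonneg hC (Real.rpow_nonneg (Nat.cast_nonneg N) _)
    linarith
  -- the constant floor of the shifted resistance
  have hF' : ∀ N : ℕ, max N₁ 2 ≤ N → 1 * (N : ℝ) ^ (0 : ℝ) ≤ 1 / escapeDeficit ω₂ lam β γ T N - C := by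
    intro N hN
    rw [Real.rpow_zero, one_mul]
    have hE := hpos N (le_trans (le_max_right _ _) hN)
    have hle := hN₁ N (le_trans (le_max_left _ _) hN)
    have hCE : C + 1 ≤ 1 / escapeDeficit ω₂ lam β γ T N := (le_one_div (by positivity) hE).2 hle
    linarith
  obtain ⟨a, ha, N₀, hlin⟩ := JunctionDefectGrading.linear_of_split_of_floor
    (r := fun N => 1 / escapeDeficit ω₂ lam β γ T N - C) (θ := -1) (s := 0)
    (by norm_num) le_rfl (by norm_num) hb hC one_pos hJ' hF'
  refine ⟨1 / a, max N₀ 2, fun N hN => ?_⟩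
  have hE := hpos N (le_trans (le_max_right _ _) hN)
  have hNpos : (0 : ℝ) < N := by
    exact_mod_cast lt_of_lt_of_le (by norm_num) (le_trans (le_max_right N₀ 2) hN)
  have h : a * (N : ℝ) ≤ 1 / escapeDeficit ω₂ lam β γ T N - C := hlin N (le_trans (le_max_left _ _) hN)
  have h0 : a * (N : ℝ) ≤ 1 / escapeDeficit ω₂ lam β γ T N := by linarith
  have h' : a * (N : ℝ) * escapeDeficit ω₂ lam β γ T N ≤ 1 := (le_div_iff₀ hE).mp h0
  rw [div_div, le_div_iff₀ (mul_pos ha hNpos)]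
  calc escapeDeficit ω₂ lam β γ T N * (a * N) = a * (N : ℝ) * escapeDeficit ω₂ lam β γ T N := by ring
    _ ≤ 1 := h'

/-- `SplitLaw 0` at one temperature, with the literal `C·N^0` rewritten to `C`. [folklore] -/
theorem splitZeroAt_of_splitLaw_zero (hS : JunctionDefectGrading.SplitLaw 0) {ω₂ lam β γ : ℝ} (hω : 0 < ω₂) (hl : 0 < lam)
    (hβ : 0 < β) (hγ : 0 < γ) {T : ℝ} (hT : 0 < T) :
    ∃ C : ℝ, 0 ≤ C ∧ ∃ b : ℝ, b < 1 ∧ ∃ N₂ : ℕ, ∀ N : ℕ, N₂ ≤ N → ∃ u v : ℕ, N ≤ 3 * u ∧ N ≤ 3 * v ∧ u + v ≤ N ∧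
      (N : ℝ) - u - v ≤ C * (N : ℝ) ^ b ∧
      1 / escapeDeficit ω₂ lam β γ T u + 1 / escapeDeficit ω₂ lam β γ T v - C ≤ 1 / escapeDeficit ω₂ lam β γ T N := by
  obtain ⟨C, hC, b, hb, N₂, hS'⟩ := hS ω₂ lam β γ hω hl hβ hγ T hT
  refine ⟨C, hC, b, hb, N₂, fun N hN => ?_⟩
  obtain ⟨u, v, h1, h2, h3, h4, h5⟩ := hS' N hN
  refine ⟨u, v, h1, h2, h3, h4, ?_⟩
  simpa only [Real.rpow_zero, mul_one] using h5

/-! ## `EscapeVanishing` — the escape-deficit currency of `NoBallisticChannel` (stmt-28286) -/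

/-- **`F(0⁺)` without rate:** for all parameters and every `T > 0`, `E_N(T) → 0` as `N → ∞` — complete first-order thermalisation of
the thermostatted site, no ballistic channel.  EQUIV to CET's crux `NoBallisticChannel` 28286 (`escapeVanishing_iff_noBallisticChannel`);
implied by every rung `ExponentFloor s`, `s > 0`, by `CurrentCorrectorBudget a`, `a < 3`, by E1; phonon-false (`E_N^{harm} → E_∞ > 0`).
UNDECIDED (open problem, BLR 2000 §6.3).  Typed so that the zero-defect junction kernel has a rate-free partner. [piece · rung] -/
def EscapeVanishing : Prop :=
  ∀ ω₂ lam β γ : ℝ, 0 < ω₂ → 0 < lam → 0 < β → 0 < γ → ∀ T : ℝ, 0 < T →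
    Tendsto (fun N : ℕ => escapeDeficit ω₂ lam β γ T N) atTop (𝓝 0)

/-- Every positive rung gives `EscapeVanishing` (`max C 0 / N^s → 0`, `E_N ≥ 0`). [folklore] -/
theorem escapeVanishing_of_exponentFloor {s : ℝ} (hs : 0 < s) (hF : ExponentFloor s) : EscapeVanishing := by
  intro ω₂ lam β γ hω hl hβ hγ T hT
  obtain ⟨C, N₀, hfl⟩ := hF ω₂ lam β γ hω hl hβ hγ T hT
  have hpow : Tendsto (fun N : ℕ => ((N : ℝ)) ^ s) atTop atTop :=
    (tendsto_rpow_atTop hs).comp tendsto_natCast_atTop_atTop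
  have hg : Tendsto (fun N : ℕ => max C 0 / ((N : ℝ)) ^ s) atTop (𝓝 0) := tendsto_const_nhds.div_atTop hpow
  refine squeeze_zero' ?_ ?_ hg
  · filter_upwards [eventually_ge_atTop 2] with N hN using escapeDeficit_nonneg' hω hl hβ hγ hT hN
  · filter_upwards [eventually_ge_atTop (max N₀ 1)] with N hN
    have hNpos : (0 : ℝ) < N := by exact_mod_cast lt_of_lt_of_le zero_lt_one (le_trans (le_max_right _ _) hN)
    exact le_trans (hfl N (le_trans (le_max_left _ _) hN))
      (div_le_div_of_nonneg_right (le_max_left C 0) (Real.rpow_pos_of_pos hNpos s).le)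

/-- 11071 gives `EscapeVanishing` (via `F(1)`). [folklore] -/
theorem escapeVanishing_of_boundedResponse (h : BoundedResponse) : EscapeVanishing :=
  escapeVanishing_of_exponentFloor one_pos (exponentFloor_one_iff_boundedResponse.2 h)

/-- `CurrentCorrectorBudget a` with `a < 3` gives `EscapeVanishing` (via `F((3−a)/2)`, file (7c)). [kernel · frame] -/
theorem escapeVanishing_of_currentCorrectorBudget {a : ℝ} (ha : a < 3) (hE : CurrentCorrectorBudget a) : EscapeVanishing :=
  escapeVanishing_of_exponentFloor (by linarith) (exponentFloor_of_currentCorrectorBudget hE)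

/-! ## The zero-defect node, escape-deficit currency -/

/-- **`SplitLaw 0 → EscapeVanishing → OhmicFloor`** — the constant-defect split law needs no rate on the floor side. [kernel · frame] -/
theorem ohmicFloor_of_splitLaw_zero_of_escapeVanishing (hS : JunctionDefectGrading.SplitLaw 0) (hV : EscapeVanishing) :
    OhmicFloor := by
  intro ω₂ lam β γ hω hl hβ hγ T hT
  obtain ⟨C, hC, b, hb, N₂, hS'⟩ := splitZeroAt_of_splitLaw_zero hS hω hl hβ hγ hT
  exact escapeFloor_one_of_splitZero_of_tendsto hω hl hβ hγ hT hC hb hS' (hV ω₂ lam β γ hω hl hβ hγ T hT)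

/-- **`SplitLaw 0 → EscapeVanishing → BoundedResponse` (11071).** [kernel · frame] -/
theorem boundedResponse_of_splitLaw_zero_of_escapeVanishing (hS : JunctionDefectGrading.SplitLaw 0) (hV : EscapeVanishing) :
    BoundedResponse :=
  ohmicFloor_iff_boundedResponse.1 (ohmicFloor_of_splitLaw_zero_of_escapeVanishing hS hV)

/-- Every non-positive defect exponent: `SplitLaw θ → EscapeVanishing → BoundedResponse` for `θ ≤ 0` (`splitLaw_mono`). [kernel · frame] -/
theorem boundedResponse_of_splitLaw_nonpos_of_escapeVanishing {θ : ℝ} (hθ : θ ≤ 0) (hS : JunctionDefectGrading.SplitLaw θ)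
    (hV : EscapeVanishing) : BoundedResponse :=
  boundedResponse_of_splitLaw_zero_of_escapeVanishing (JunctionDefectGrading.splitLaw_mono hθ hS) hV

/-- **`BufferedJunctionLaw → EscapeVanishing → BoundedResponse`** (file (5): `BufferedJunctionLaw → SplitLaw 0`). [kernel · frame] -/
theorem boundedResponse_of_bufferedJunctionLaw_of_escapeVanishing (hB : JunctionDefectGrading.BufferedJunctionLaw)
    (hV : EscapeVanishing) : BoundedResponse :=
  boundedResponse_of_splitLaw_zero_of_escapeVanishing (JunctionDefectGrading.splitLaw_zero_of_bufferedJunctionLaw hB) hV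

/-- **`LocalityPassivityLaw → EscapeVanishing → BoundedResponse`** (file (5): junction locality + buffer passivity give `SplitLaw 0`).
[kernel · frame] -/
theorem boundedResponse_of_localityPassivityLaw_of_escapeVanishing (hL : JunctionDefectGrading.LocalityPassivityLaw)
    (hV : EscapeVanishing) : BoundedResponse :=
  boundedResponse_of_splitLaw_zero_of_escapeVanishing (JunctionDefectGrading.splitLaw_zero_of_locality_of_passivity hL) hV

/-! ## The bridge to the ledger item: `EscapeVanishing ⟺ NoBallisticChannel` (stmt-28286) -/

/-- **`EscapeVanishing ⟹ NoBallisticChannel`.**  Along ANY steady-state family with response coefficients `D`, uniqueness of limits in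
`𝓝[≠] 0` and the proved response identity give `D_N = (N−1)γE_N` (`N ≥ 1`), so `0 ≤ D_N/N ≤ γE_N → 0`. [folklore] -/
theorem noBallisticChannel_of_escapeVanishing (hV : EscapeVanishing) : NoBallisticChannel := by
  intro ω₂ lam β γ hω hl hβ hγ _ μ hμ T hT D hD
  have huniq := bondHeatUncertainty_nessUnique_holds ω₂ lam β γ hω hl hβ hγ
  have hRI := boundaryEscapeDeficit_responseIdentity_holds ω₂ lam β γ hω hl hβ hγ huniq μ hμ T hT
  dsimp only at hRI
  have hDpos : ∀ N : ℕ, 0 < N → D N = ((N : ℝ) - 1) * γ * escapeDeficit ω₂ lam β γ T N := fun N hN =>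
    tendsto_nhds_unique (hD N) (hRI N hN).2
  exact tendsto_response_div_zero_of_escape (E := fun N => escapeDeficit ω₂ lam β γ T N) hγ
    (fun N hN => escapeDeficit_nonneg' hω hl hβ hγ hT hN) hDpos (hV ω₂ lam β γ hω hl hβ hγ T hT)

/-- **`NoBallisticChannel ⟹ EscapeVanishing`.**  Along the canonical steady-state family (existence + choice), the proved response identity
makes `D_N := (N−1)γE_N` (`D_0 = 0` by `totalCurrent_zero`) a sequence of response coefficients; `D_N/N → 0` then gives
`E_N ≤ (2/γ)·D_N/N → 0`. [folklore] -/
theorem escapeVanishing_of_noBallisticChannel (hB : NoBallisticChannel) : EscapeVanishing := by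
  intro ω₂ lam β γ hω hl hβ hγ T hT
  classical
  have huniq := bondHeatUncertainty_nessUnique_holds ω₂ lam β γ hω hl hβ hγ
  let μ₀ : (N : ℕ) → ℝ → ℝ → MeasureTheory.Measure (PhaseSpace N) := fun N T_L T_R =>
    if h : 0 < T_L ∧ 0 < T_R then
      Classical.choose (pinnedChain_exists_isSteadyState hω hl hβ hγ N h.1 h.2) else 0
  have hμ₀ : ∀ (N : ℕ) (T_L T_R : ℝ), 0 < T_L → 0 < T_R →
      (pinnedChain ω₂ lam β γ).IsSteadyState N T_L T_R (μ₀ N T_L T_R) := by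
    intro N T_L T_R hL' hR'
    simp only [μ₀, dif_pos (And.intro hL' hR')]
    exact Classical.choose_spec (pinnedChain_exists_isSteadyState hω hl hβ hγ N hL' hR')
  have hRI := boundaryEscapeDeficit_responseIdentity_holds ω₂ lam β γ hω hl hβ hγ huniq μ₀ hμ₀ T hT
  dsimp only at hRI
  let D : ℕ → ℝ := fun N => if N = 0 then 0 else ((N : ℝ) - 1) * γ * escapeDeficit ω₂ lam β γ T N
  have hDpos : ∀ N : ℕ, 0 < N → D N = ((N : ℝ) - 1) * γ * escapeDeficit ω₂ lam β γ T N := fun N hN => by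
    simp [D, hN.ne']
  have hD : ∀ N : ℕ, Tendsto
      (fun δ : ℝ => (pinnedChain ω₂ lam β γ).totalCurrent (μ₀ N (T + δ / 2) (T - δ / 2)) / δ)
      (𝓝[≠] 0) (𝓝 (D N)) := by
    intro N
    rcases Nat.eq_zero_or_pos N with rfl | hN
    · have hD0 : D 0 = 0 := by simp [D]
      rw [hD0]
      simp only [OscillatorChain.totalCurrent_zero, zero_div]
      exact tendsto_const_nhds
    · rw [hDpos N hN]
      exact (hRI N hN).2
  have hsub := hB ω₂ lam β γ hω hl hβ hγ huniq μ₀ hμ₀ T hT D hD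
  exact tendsto_escape_zero_of_response_div (E := fun N => escapeDeficit ω₂ lam β γ T N) hγ
    (fun N hN => escapeDeficit_nonneg' hω hl hβ hγ hT hN) hDpos hsub

/-- **`EscapeVanishing ⟺ NoBallisticChannel` (stmt-28286).** [folklore] -/
theorem escapeVanishing_iff_noBallisticChannel : EscapeVanishing ↔ NoBallisticChannel :=
  ⟨noBallisticChannel_of_escapeVanishing, escapeVanishing_of_noBallisticChannel⟩

/-! ## THE NODE with a ledger partner: 11071 ⟸ (junction piece) ∧ `NoBallisticChannel` -/

/-- **`SplitLaw 0 → NoBallisticChannel → BoundedResponse`.** [kernel · frame] -/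
theorem boundedResponse_of_splitLaw_zero_of_noBallisticChannel (hS : JunctionDefectGrading.SplitLaw 0)
    (hB : NoBallisticChannel) : BoundedResponse :=
  boundedResponse_of_splitLaw_zero_of_escapeVanishing hS (escapeVanishing_of_noBallisticChannel hB)

/-- **`BufferedJunctionLaw → NoBallisticChannel → BoundedResponse`.** [kernel · frame] -/
theorem boundedResponse_of_bufferedJunctionLaw_of_noBallisticChannel (hJ : JunctionDefectGrading.BufferedJunctionLaw)
    (hB : NoBallisticChannel) : BoundedResponse :=
  boundedResponse_of_bufferedJunctionLaw_of_escapeVanishing hJ (escapeVanishing_of_noBallisticChannel hB)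

/-- **NODE OF RECORD (rate-free form): `LocalityPassivityLaw → NoBallisticChannel → BoundedResponse`** — 11071 from junction locality +
buffer passivity (file (5)) and CET's crux 28286. [kernel · frame] -/
theorem boundedResponse_of_localityPassivityLaw_of_noBallisticChannel (hL : JunctionDefectGrading.LocalityPassivityLaw)
    (hB : NoBallisticChannel) : BoundedResponse :=
  boundedResponse_of_localityPassivityLaw_of_escapeVanishing hL (escapeVanishing_of_noBallisticChannel hB)

/-! ## CET's rank-2 crux `NoAnomalousChannel` (stmt-28285) is discharged by the zero-defect junction law -/

/-- **`SplitLaw 0 → NoAnomalousChannel`.**  Per temperature, along the GIVEN steady-state family: the response identity gives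
`D_N = (N−1)γE_N(T)`; `D_N/N → 0` gives `E_N(T) → 0`; the zero-defect kernel gives `E_N(T) ≤ C₁/N` eventually; hence
`|D_N| ≤ γ·max C₁ 0` eventually and `sup_N |D_N| < ∞`.  A constant-defect junction law admits NO anomalous exponent. [kernel · frame] -/
theorem noAnomalousChannel_of_splitLaw_zero (hS : JunctionDefectGrading.SplitLaw 0) : NoAnomalousChannel := by
  intro ω₂ lam β γ hω hl hβ hγ _ μ hμ T hT D hD hsub
  have huniq := bondHeatUncertainty_nessUnique_holds ω₂ lam β γ hω hl hβ hγ
  have hRI := boundaryEscapeDeficit_responseIdentity_holds ω₂ lam β γ hω hl hβ hγ huniq μ hμ T hT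
  dsimp only at hRI
  have hDpos : ∀ N : ℕ, 0 < N → D N = ((N : ℝ) - 1) * γ * escapeDeficit ω₂ lam β γ T N := fun N hN =>
    tendsto_nhds_unique (hD N) (hRI N hN).2
  have hE0 : ∀ N : ℕ, 2 ≤ N → 0 ≤ escapeDeficit ω₂ lam β γ T N := fun N hN => escapeDeficit_nonneg' hω hl hβ hγ hT hN
  have hV : Tendsto (fun N : ℕ => escapeDeficit ω₂ lam β γ T N) atTop (𝓝 0) :=
    tendsto_escape_zero_of_response_div (E := fun N => escapeDeficit ω₂ lam β γ T N) hγ hE0 hDpos hsub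
  obtain ⟨C, hC, b, hb, N₂, hS'⟩ := splitZeroAt_of_splitLaw_zero hS hω hl hβ hγ hT
  obtain ⟨C₁, N₀, hfl⟩ := escapeFloor_one_of_splitZero_of_tendsto hω hl hβ hγ hT hC hb hS' hV
  exact bddAbove_range_of_eventually_le
    (abs_response_le_of_escapeFloor_one (E := fun N => escapeDeficit ω₂ lam β γ T N) hγ hE0 hDpos hfl)

/-- **`BufferedJunctionLaw → NoAnomalousChannel`.** [kernel · frame] -/
theorem noAnomalousChannel_of_bufferedJunctionLaw (hJ : JunctionDefectGrading.BufferedJunctionLaw) : NoAnomalousChannel :=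
  noAnomalousChannel_of_splitLaw_zero (JunctionDefectGrading.splitLaw_zero_of_bufferedJunctionLaw hJ)

/-- **`LocalityPassivityLaw → NoAnomalousChannel`** — junction locality + buffer passivity exclude anomalous channels. [kernel · frame] -/
theorem noAnomalousChannel_of_localityPassivityLaw (hL : JunctionDefectGrading.LocalityPassivityLaw) : NoAnomalousChannel :=
  noAnomalousChannel_of_splitLaw_zero (JunctionDefectGrading.splitLaw_zero_of_locality_of_passivity hL)

/-- `SplitLaw θ → NoAnomalousChannel` for every `θ ≤ 0`. [kernel · frame] -/
theorem noAnomalousChannel_of_splitLaw_nonpos {θ : ℝ} (hθ : θ ≤ 0) (hS : JunctionDefectGrading.SplitLaw θ) : NoAnomalousChannel :=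
  noAnomalousChannel_of_splitLaw_zero (JunctionDefectGrading.splitLaw_mono hθ hS)

/-! ## The corrector side feeds the partner: E1 and every sub-phonon corrector budget give `NoBallisticChannel` -/

/-- **`CurrentCorrectorBudget a → NoBallisticChannel` for `a < 3`.** [kernel · frame] -/
theorem noBallisticChannel_of_currentCorrectorBudget {a : ℝ} (ha : a < 3) (hE : CurrentCorrectorBudget a) : NoBallisticChannel :=
  noBallisticChannel_of_escapeVanishing (escapeVanishing_of_currentCorrectorBudget ha hE)

/-- **`ConeScaleCorrector → NoBallisticChannel`** — crux E1 (stmt-14069) implies CET's crux 28286. [kernel · frame] -/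
theorem noBallisticChannel_of_coneScaleCorrector (hE : ConeScaleCorrector) : NoBallisticChannel :=
  noBallisticChannel_of_currentCorrectorBudget (by norm_num) (currentCorrectorBudget_two_of_coneScaleCorrector hE)

/-- `ExponentFloor s → NoBallisticChannel` for `s > 0`; in particular 11071 ⟹ 28286 (`s = 1`). [folklore] -/
theorem noBallisticChannel_of_exponentFloor {s : ℝ} (hs : 0 < s) (hF : ExponentFloor s) : NoBallisticChannel :=
  noBallisticChannel_of_escapeVanishing (escapeVanishing_of_exponentFloor hs hF)

/-- 11071 ⟹ `NoBallisticChannel` (stmt-28286): the partner is WEAKER than the blocker. [folklore] -/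
theorem noBallisticChannel_of_boundedResponse (h : BoundedResponse) : NoBallisticChannel :=
  noBallisticChannel_of_exponentFloor one_pos (exponentFloor_one_iff_boundedResponse.2 h)

/-- 11071 ⟹ `NoAnomalousChannel` (stmt-28285), trivially (its conclusion is bounded response along the given family). [folklore] -/
theorem noAnomalousChannel_of_boundedResponse (h : BoundedResponse) : NoAnomalousChannel :=
  fun ω₂ lam β γ hω hl hβ hγ _ μ hμ T hT D hD _ => h ω₂ lam β γ hω hl hβ hγ μ hμ T hT D hD

end EscapeGrading

end Summit.AtomisticToContinuum.FouriersLaw.Theorems.SubdiffusiveBondHeat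

end
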